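import Summits.BirchSwinnertonDyer.BirchSwinnertonDyer.Theorems.CyclotomicUntwistCompanionShapeTransport
import Summits.BirchSwinnertonDyer.BirchSwinnertonDyer.Theorems.CyclotomicUntwistCompanionShapeSemistable
import Summits.BirchSwinnertonDyer.Rank1Residual.O5.CompanionTypeLawThreeHolds
import Summits.BirchSwinnertonDyer.Rank1Residual.O5.O5LocalShapeProofs
import Summits.BirchSwinnertonDyer.Rank1Residual.Additive.WildThreeResidualShapeLaws
import Summits.BirchSwinnertonDyer.Rank1Residual.Additive.WildThreeStableLineSignByC6
import HarnessLib

/-!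
# The P-SHAPE-PARTNER law `Additive.CompanionShapeLawThree` is a THEOREM
# (route `CyclotomicUntwist`, K1 `PSRankOneLowerHalfAtThree` supply — O6 lane V10, steps (M2) + (M4);
# cell `bsd-wall`, seat `bsd-line-cycu-p2` g5; `--supports stmt-BirchSwinnertonDyer-21580`;
# THEOREMS ONLY, no definition, no named fact; the `@[conjecture]` restamp of the node is the O6
# typer's pen)

`Additive/WildThreeResidualShapeLaws.lean` §2 typed the census law P-SHAPE-PARTNER (o6-r1 GEN 10,
EVIDENCE 20 321 joined classes / 0 violations) as
`@[conjecture] CompanionShapeLawThree`: for `W / ℚ` (wild at `3`, `ρ̄_{W,3}` irreducible) and a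
SEMISTABLE companion `G` at `3` (`O5.IsCompanionAtThree W G`: `9 ∤ N_G` and
`a_ℓ(W) ≡ a_ℓ(G) (mod 3)` off `3 N_W N_G`), with `c₃(G) = G.LFunction 3`:
`W` is not ET-side; `W` is IRR iff `3 ∣ c₃(G)`; ORD1 `⟹ c₃(G) ≡ 1`; ORDM `⟹ c₃(G) ≡ −1 (mod 3)`.

PROOF (all inputs are tree theorems).
1. `ρ̄_{G,3} ≅ ρ̄_{W,3}` (`O5.modThreeTransport_of_isCompanionAtThree`: Brauer–Nesbitt–Chebotarev,
   harvest-2 E109), restricted to `G_{ℚ₃}` (`O5.isLocallyCongruentModThreeAt3_of_equivariant`): an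
   equivariant `f : (G⁄ℚ₃)[3] ≃+ (W⁄ℚ₃)[3]`.
2. IRR: `ShapeIrrThree W ↔ LocIrr W 3` (`O5.locIrr_three_iff_forall_not_isRoot`, E89) `↔ 3 ∣ c₃(G)`
   (`O5.dvd_lFunction_three_iff_locIrr_three_of_equivariant`, x11b3-p4).
3. One stable line `x₀` of `W`: by (M1) (`…CompanionShapeTransport`: the line character is the
   square class of `F(x₀) = Ψ₂²(x₀)`, transported along `f`; uniqueness transports) `G⁄ℚ₃` has a
   unique stable line `x_G` and `F_W(x₀) = c²·F_G(x_G)`, `c ∈ ℚ₃ˣ`; by x11b3-p8's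
   `stableLineSignThree_eq_c₆_mul` (ANY model) `F_G(x_G) = (−1/216)·c₆(G)·(1 + O(3))`; by (M3)
   (`…CompanionShapeSemistable`) `3 ∤ c₆(G)` and `c₃(G) ≡ −c₆(G) (mod 3)`; by (M2) (square-class
   invariance, this file §1) `v₃F_W(x₀) ≡ v₃(c₆(G)) − 3 = −3` is ODD — so `W` is ORD-side, never
   ET-side — and the unit part of `F_W(x₀)` is `≡ c₆(G) ≡ −c₃(G)`: ORD1 (`≡ −1`) iff `c₃ ≡ +1`,
   ORDM (`≡ +1`) iff `c₃ ≡ −1`.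
The binders `ClassO6 W 3` and `[W.IsGloballyMinimal]`-minimality play no role beyond typing;
`companionShape_of_equivariant` is the hypothesis-free form over any equivariant `G[3] ≃+ W[3]`
with `9 ∤ N_G`.

HONEST FRAMING: a census-mined `@[conjecture]` node of cell `b2b-bsdres` becomes a theorem
(`companionShapeLawThree_holds`); nothing about any particular curve is asserted; no mark of any
residual map moves; K1/K2 of the route are neither proved nor reduced; BSD is not proved for any
curve. References: [Serre1972] §1.11 Prop. 11–12; [DarmonDiamondTaylor1995] Prop. 2.6(b);
[SilvermanAEC2009] VII.5.1(b), §C.16; [Edixhoven1992] Thms. 2.5–2.6 (the node's citations).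
-/

set_option linter.dupNamespace false

noncomputable section

open scoped Classical

namespace Summit.BirchSwinnertonDyer.BirchSwinnertonDyer.Theorems.CompanionShape

open Polynomial WeierstrassCurve Literature.NumberTheory.EllipticCurves
  Summit.BirchSwinnertonDyer.Rank1Residual.Additive Summit.BirchSwinnertonDyer.Rank1Residual

/-! ## §1 (M2) Square-class invariance of the shape data in `ℚ₃` -/

/-- The unit part of a non-zero square is `≡ 1 (mod 3)` (`u² − 1 = (u − 1)(u + 1)` and a `3`-adic
unit is `≡ ±1`). [folklore] -/
theorem norm_unitPartThree_sq_sub_one_lt {c : ℚ_[3]} (hc : c ≠ 0) :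
    ‖unitPartThree (c ^ 2) - 1‖ < 1 := by
  rw [sq, unitPartThree_mul hc hc, ← sq]
  set w := unitPartThree c
  have hw1 : ‖w‖ = 1 := norm_unitPartThree hc
  have key : ∀ ε : ℚ_[3], (ε = 1 ∨ ε = -1) → ‖w - ε‖ < 1 → ‖w ^ 2 - 1‖ < 1 := by
    rintro ε hε hlt
    have hfac : w ^ 2 - 1 = (w - ε) * (w + ε) := by rcases hε with rfl | rfl <;> ring
    rw [hfac, norm_mul]
    have hle : ‖w + ε‖ ≤ 1 := by
      refine (Padic.nonarchimedean _ _).trans (max_le hw1.le ?_)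
      rcases hε with rfl | rfl <;> simp
    calc ‖w - ε‖ * ‖w + ε‖ ≤ ‖w - ε‖ * 1 := mul_le_mul_of_nonneg_left hle (norm_nonneg _)
      _ < 1 := by rw [mul_one]; exact hlt
  rcases unitPartCongThree_one_or_neg_one hc with h1 | h2
  · exact key 1 (Or.inl rfl) h1
  · exact key (-1) (Or.inr rfl) h2

/-- **(M2) the shape data are square-class invariants**: for `c, t ≠ 0`,
`v₃(c²t) = 2v₃(c) + v₃(t)` (same parity) and the unit parts of `c²t` and `t` lie in the same class
mod `3`. [folklore] -/
theorem sq_mul_shape_invariant {c t : ℚ_[3]} (hc : c ≠ 0) (ht : t ≠ 0) :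
    (c ^ 2 * t).valuation = 2 * c.valuation + t.valuation ∧
      ∀ ε : ℚ_[3], (UnitPartCongThree (c ^ 2 * t) ε ↔ UnitPartCongThree t ε) := by
  refine ⟨?_, fun ε ↦ unitPartCongThree_mul_iff (pow_ne_zero 2 hc) ht
    (norm_unitPartThree_sq_sub_one_lt hc)⟩
  rw [Padic.valuation_mul (pow_ne_zero 2 hc) ht, Padic.valuation_pow]
  push_cast
  ring

/-- An integer prime to `3` is its own unit part: `UnitPartCongThree n ε ↔ ‖n − ε‖₃ < 1`. [folklore] -/
theorem unitPartCongThree_intCast_iff {n : ℤ} (hn : ¬ (3 : ℤ) ∣ n) (ε : ℚ_[3]) :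
    UnitPartCongThree (n : ℚ_[3]) ε ↔ ‖(n : ℚ_[3]) - ε‖ < 1 := by
  have hv : (n : ℚ_[3]).valuation = 0 := by
    rw [Padic.valuation_intCast, padicValInt.eq_zero_of_not_dvd hn, Nat.cast_zero]
  unfold UnitPartCongThree unitPartThree
  rw [hv, neg_zero, zpow_zero, mul_one]

/-! ## §2 (M4) The shape of `W[3]|G_{ℚ₃}` along an equivariant `G[3] ≅ W[3]`, `G` semistable at `3` -/

section Law

variable (W G : WeierstrassCurve ℚ) [W.IsElliptic] [W.IsGloballyMinimal] [G.IsElliptic]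
  [G.IsGloballyMinimal]

omit [W.IsGloballyMinimal] in
/-- **The sign of the stable line is read by a semistable companion.** For globally minimal
elliptic `W, G / ℚ`, a `Gal(ℚ̄/ℚ)`-equivariant `e : G[3] ≃+ W[3]`, `9 ∤ N_G`, and `x₀` THE stable
line of `W` at `3`: `v₃ F(x₀)` is ODD, the unit part of `F(x₀)` is `≡ c₆(G_ℤ)`, `3 ∤ c₆(G_ℤ)` and
`c₃(G) ≡ −c₆(G_ℤ) (mod 3)`. [cite: Serre1972, §1.11 Prop. 11–12] -/
theorem sign_of_equivariant_semistable (e : geomTorsion G (3 : ℤ) ≃+ geomTorsion W (3 : ℤ))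
    (he : ∀ (σ : Field.absoluteGaloisGroup ℚ) (P : geomTorsion G (3 : ℤ)), e (σ • P) = σ • e P)
    (h9 : ¬ 9 ∣ G.conductorNorm ℤ) {x₀ : ℚ_[3]} (hx : IsUniqueStableLineThree W x₀) :
    Odd (stableLineSignThree W x₀).valuation ∧
      (∀ ε : ℚ_[3], UnitPartCongThree (stableLineSignThree W x₀) ε ↔
        ‖(((integralModelInt G).c₆ : ℤ) : ℚ_[3]) - ε‖ < 1) ∧
      ¬ (3 : ℤ) ∣ (integralModelInt G).c₆ ∧
      ((G.LFunction 3 : ℤ) : ZMod 3) = -(((integralModelInt G).c₆ : ℤ) : ZMod 3) := by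
  -- the local equivariant isomorphism over `ℚ₃`
  obtain ⟨f, hf⟩ := O5.isLocallyCongruentModThreeAt3_of_equivariant G W e he
  -- `W[3]|G_{ℚ₃}` reducible ⟹ `G[3]|G_{ℚ₃}` reducible ⟹ (M3)
  have hredW : ¬ LocIrr W 3 := O5.not_locIrr_three_of_isRoot W hx.1
  have hredG : ¬ LocIrr G 3 := fun hG ↦ hredW ((locIrr_iff_of_equivariant W G 3 e he).mpr hG)
  obtain ⟨hc₆, hL⟩ := not_dvd_c₆_and_lFunction_three_eq_of_not_locIrr G h9 hredG
  -- the unique stable line `x_G` of `G` over `ℚ₃` (M1, M1′)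
  obtain ⟨xG, hxG, -⟩ := exists_isRoot_Ψ₃_sq_mul_of_equivariant (W.baseChange ℚ_[3])
    (G.baseChange ℚ_[3]) f.symm (equivariant_symm _ _ f hf) hx.1
  have hxGu : IsUniqueStableLineThree G xG :=
    ⟨hxG, fun r hr ↦ isRoot_Ψ₃_unique_of_equivariant (G.baseChange ℚ_[3]) (W.baseChange ℚ_[3]) f hf
      hx.2 hr hxG⟩
  -- its sign goes to `W`'s (M1)
  obtain ⟨x₁, hx₁, c, hc0, hc⟩ := exists_isRoot_Ψ₃_sq_mul_of_equivariant (G.baseChange ℚ_[3])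
    (W.baseChange ℚ_[3]) f hf hxG
  rw [hx.2 x₁ hx₁] at hc
  change stableLineSignThree W x₀ = c ^ 2 * stableLineSignThree G xG at hc
  -- `F_G(x_G)`: valuation `v₃(c₆(G)) − 3 = −3`, unit part `≡ c₆(G)`
  obtain ⟨hsG0, hvG⟩ := valuation_stableLineSignThree G hxGu
  have hGc₆ : G.c₆ = ((integralModelInt G).c₆ : ℚ) := by
    have h := (integralModelInt G).map_c₆ (Int.castRingHom ℚ)
    rw [map_integralModelInt, eq_intCast] at h
    exact h
  have hv0 : padicValRat 3 G.c₆ = 0 := by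
    rw [hGc₆, padicValRat.of_int, padicValInt.eq_zero_of_not_dvd hc₆, Nat.cast_zero]
  obtain ⟨hval, hunit⟩ := sq_mul_shape_invariant hc0 hsG0
  refine ⟨?_, fun ε ↦ ?_, hc₆, hL⟩
  · rw [hc, hval, hvG, hv0]
    exact ⟨c.valuation - 2, by ring⟩
  · rw [hc, hunit ε, unitPartCongThree_stableLineSignThree_iff G hxGu ε, hGc₆, Rat.cast_intCast,
      unitPartCongThree_intCast_iff hc₆]

omit [W.IsGloballyMinimal] in
/-- **The law over any equivariant `G[3] ≃+ W[3]` with `G` semistable at `3`** (no companion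
predicate, no class hypothesis): not ET-side; IRR iff `3 ∣ c₃(G)`; ORD1 `⟹ c₃ ≡ 1`; ORDM `⟹ c₃ ≡ −1`.
[cite: Serre1972, §1.11 Prop. 11–12] -/
theorem companionShape_of_equivariant (e : geomTorsion G (3 : ℤ) ≃+ geomTorsion W (3 : ℤ))
    (he : ∀ (σ : Field.absoluteGaloisGroup ℚ) (P : geomTorsion G (3 : ℤ)), e (σ • P) = σ • e P)
    (h9 : ¬ 9 ∣ G.conductorNorm ℤ) :
    ¬ ShapeEtSideThree W ∧
      (ShapeIrrThree W ↔ ((G.LFunction 3 : ℤ) : ZMod 3) = 0) ∧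
      (ShapeORD1Three W → ((G.LFunction 3 : ℤ) : ZMod 3) = 1) ∧
      (ShapeORDMThree W → ((G.LFunction 3 : ℤ) : ZMod 3) = -1) := by
  have hcast : ∀ (ε : ℤ), ‖(((integralModelInt G).c₆ : ℤ) : ℚ_[3]) - (ε : ℚ_[3])‖ < 1 →
      (((integralModelInt G).c₆ : ℤ) : ZMod 3) = (ε : ZMod 3) := by
    intro ε h
    rw [← Int.cast_sub, Padic.norm_intCast_lt_one_iff] at h
    have h' := (ZMod.intCast_zmod_eq_zero_iff_dvd _ 3).mpr h
    push_cast at h'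
    exact sub_eq_zero.mp h'
  refine ⟨?_, ?_, ?_, ?_⟩
  · rintro (⟨x₀, hx, -, hev, -⟩ | ⟨x₀, hx, -, hev, -⟩) <;>
      exact (Int.not_odd_iff_even.mpr hev) (sign_of_equivariant_semistable W G e he h9 hx).1
  · rw [show ShapeIrrThree W ↔ LocIrr W 3 from (O5.locIrr_three_iff_forall_not_isRoot W).symm,
      ← O5.dvd_lFunction_three_iff_locIrr_three_of_equivariant W G e he h9,
      ZMod.intCast_zmod_eq_zero_iff_dvd]
    norm_cast
  · rintro ⟨x₀, hx, -, -, hm⟩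
    obtain ⟨-, hunit, -, hL⟩ := sign_of_equivariant_semistable W G e he h9 hx
    have h := hcast (-1) (by exact_mod_cast (hunit (-1)).mp hm)
    rw [hL, h]
    push_cast
    ring
  · rintro ⟨x₀, hx, -, -, hp⟩
    obtain ⟨-, hunit, -, hL⟩ := sign_of_equivariant_semistable W G e he h9 hx
    have h := hcast 1 (by exact_mod_cast (hunit 1).mp hp)
    rw [hL, h]
    push_cast
    ring

end Law

/-! ## §3 The node -/

/-- **P-SHAPE-PARTNER `Additive.CompanionShapeLawThree` HOLDS** (THEOREM-CANDIDATE ↦ THEOREM;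
EVIDENCE 20 321/0 of o6-r1 GEN 10 was its certificate): a semistable companion `G` at `3` of a wild
`W` with `ρ̄_{W,3}` irreducible reads the shape of `W[3]|G_{ℚ₃}` in its third `L`-coefficient —
never ET-side, IRR iff `3 ∣ c₃(G)`, ORD1 `⟹ c₃ ≡ 1`, ORDM `⟹ c₃ ≡ −1`. Composition:
`O5.modThreeTransport_of_isCompanionAtThree` (Brauer–Nesbitt–Chebotarev) and
`companionShape_of_equivariant`; the binder `ClassO6 W 3` is not used.
[cite: Serre1972, §1.11 Prop. 11–12] [cite: DarmonDiamondTaylor1995, Prop. 2.6 (b) (PDF p. 53)] -/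
theorem companionShapeLawThree_holds : CompanionShapeLawThree := by
  intro W G _ _ _ _ _hO6 hirr hcomp
  obtain ⟨e, he⟩ := O5.modThreeTransport_of_isCompanionAtThree W G hirr hcomp
  exact companionShape_of_equivariant W G e he hcomp.1

end Summit.BirchSwinnertonDyer.BirchSwinnertonDyer.Theorems.CompanionShape

end
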